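import Literature.MathematicalPhysics.QuantumFieldTheory.Balaban1983to89.B9Eq326LocalPartTowerSliceGradientRow
import Literature.MathematicalPhysics.QuantumFieldTheory.Balaban1983to89.B9Eq326LocalPartTowerZerothOrderCoshRow

/-!
# `Balaban1983to89.B9Eq326LocalInvTowerSliceGradientRow` — T. Bałaban, *Propagators for lattice gauge theories in a background field*, Commun. Math. Phys.
# **99** (1985) 389–434 [Balaban1985BackgroundPropagators] Thm 3.1 (3.42) p. 397 SECOND ENTRY, (3.3) p. 391, (3.26) p. 395, (3.23) p. 394, (3.49) p. 399, (3.69)–(3.73)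
# pp. 404–405, Thm 3.13 p. 426, with [Balaban1985Variational] (115) p. 294, (117) p. 295, (134)–(136) p. 298: **THE COVARIANT (SLICE) GRADIENT ROW OF THE
# TOWER LOCAL PART `A₀,k = Δ(U) + D_UD*_U + Q_k(U)†(a•Q_k(U))`, THE VALUE ROW DISPLAYED — for a source `f` supported over the bonds of ONE unit block `v` with
# `‖f(b)‖ ≤ F`, every fine bond `b` of `T_{(L^{n+1}m)}` and every component `μ`:
# `‖(D_U (A₀,k⁻¹f)_μ)(b)‖ ≤ 2e^{θ(L^{n+1}−1)}·((2‖η⁻¹‖) + (2(‖η⁻¹‖((c_P + m_c) + dη⁻²(b′ + b²)) + |η⁻¹|b∕β)·C_u)·B_{b.2}·F·e^{−κ·d_m(Πb₊, v)}`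
# given the decayed value row `‖(A₀,k⁻¹f)(b)‖ ≤ C_u·F·e^{−κ·d_m(Πb₋, v)}` (DISPLAYED; ne9-leaf-03's (EA0S)∕(ECL) supply it), `b = 2M_φM_φ′ε_t`, `b′ = 2M_φM_φ′a_U`,
# `c_P` the constant of ne9-leaf-03's (TZC) `B9Eq326LocalPartTowerZerothOrderCoshRow` at `κ := η⁻²`** — this lineage's (VGT-a)
# `B9Eq326LocalPartTowerSliceGradientRow.norm_covDerivL2K_slice_le_bigBlockLetter_smallGauge` (generic order-zero part) at `u := A₀,k⁻¹f`,
# `P := Δ′ + Q_k†(a•Q_k) − η⁻²𝒦`; the slice twin of ne9-leaf-03's (DVT) `B9Eq326LocalPartTowerDivergenceRow` §2 ON THE SAME BINDER LIST, so that the divergence row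
# (the VALUE member of (117)'s `D*_UG₁,k`) and the gradient row (the `|∇·|_{(−2)}` member) of `A₀,k⁻¹` are read on one data block; NE9 owner INTENT-2 gen 96,
# journal [NE9P1-G96-INTENT-2]

statement-level skeleton of published theorems with citation tags; proofs where landed; nothing here is a claim about the Yang–Mills mass gap

CITATION HEADER (lean-in-tree rule).  Audit cell `pub-balaban`, sub-cell `t4`, BINDER row NE9; filed by the NE9 BINDER-row OWNER lineage `b2b-balaban-t4-ne9-p1`
(gen 96).  Imports this lineage's (VGT-a) `B9Eq326LocalPartTowerSliceGradientRow` (through it (K48), (GT), (K54)) and ne9-leaf-03's (TZC)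
`B9Eq326LocalPartTowerZerothOrderCoshRow` (the `hPuv` slot at the tower; through it `B9Eq326LocalPartKatoForm`, (ECL), (PSK), (K59)).  SOURCE READ first-hand in
the held text layer [Balaban1985BackgroundPropagators] (`paper:balaban1985-cmp99-background-propagators`, journal page = PDF page + 388): p. 391 (3.3), p. 397
Thm 3.1 (3.42), p. 395 (3.26), p. 394 (3.23), p. 399 (3.49), pp. 404–405 (3.69)–(3.73), p. 426 Thm 3.13; [Balaban1985Variational] p. 294 (115), p. 295 (117), p. 298
(134)–(136).  Print proves the gradient rows by the random walk of Sect. 3 pp. 398–409; the cell's road is storey J ((K41)) on the Kato-domination value row —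
[folklore] composition BY NAME; NOTHING of print's proof is reproduced; nothing printed is a hypothesis except the model letters; the `[cite: …]` tags are TEXT
LOCATIONS.

WHAT IS PROVED (sorry-free; proof lane — 0 `def`; [folklore]).
* §1 **`norm_covDerivL2K_slice_localInvK_le_bigBlockLetter`** — the slice-gradient row of `A₀,k⁻¹f` (`B11Eq103H1Complex.greenK` ∕ `apply_greenK`): (VGT-a) §1
  at `t := η⁻¹`, `P := Δ′ + Q_k†(a•Q_k) − η⁻²𝒦` by `B9Eq326LocalPartKatoForm.localPart_eq_kato_add`, `hPuv :=` (TZC)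
  `norm_zerothOrder_apply_le_weighted_cosh_tower`; binder list = (DVT) §2's VERBATIM + `(μ : Fin d) (bnd : Bond d (towerP L m (n+1)))`.
* §2 **`norm_covGrad_localInvK_le_bigBlockLetter`** — THE SAME, read as `‖(B9Eq33CovDerivVector.covGrad η⁻¹ (Ad U) (A₀,k⁻¹f))(b, μ)‖` ((VGT-a) §3
  `norm_covGrad_apply_le_of_slice`): the letter `B11Eq111FrakG.nabla115 η U` of the space (115) applied to `A₀,k⁻¹f`, pointwise.
HONEST SCOPE.  Composition BY NAME; DISPLAYED: the decayed value row (`C_u`, `κ ≤ θL^{n+1}`), (T) contractions, the big-block family `P_y`, the MODEL letters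
(`U(b) ∈ U1`, `‖U(b) − 1‖ ≤ ε_t`, the bond-gradient datum `a_U`, the plaquette letters `δ`, the `Q_k` regularity letters, the diagonal `c₀(L^{n+1})^d = c₁`),
storey J's windows (`θ`, `m_c`, `β`, `κ′`, `C`, `K`), the positivity `hpos₀` of `A₀,k` (free from Thm 3.11's `hpos` by (LPC) `localK_pos_of_pos`, not used here);
every constant symbolic and crude; the tower-specific letters are displayed as they fall (height-free on print's diagonal — the companion closing (VGTD), not
here); the rows of `G₁,k` itself (Woodbury) are NOT here; nothing of [B9] Thm 3.1∕3.3∕3.11∕3.13 is asserted, valued or discharged.  NOT NE9 (cell pub-balaban: NE9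
NOT PRINTED ∕ NOT PROVED; «NE9 ⇐ the named binders»; row WALLED ON A MODEL (O-NE9-1; #5 UNRULED); spine PROVED 0∕9; rung (B)+1 on a finite T⁴ — NOT infinite volume,
NOT mass gap, NOT BetaPertH, NOT Clay; HONEST DEPENDENCY: continuum YM on T⁴ ⇐ BetaPertH ∧ nine spine estimates (0/9 proved); BetaPertH ⇐ (D1) ∧ (D4) ∧ CAP+tail;
G-an2-4 gates asym, D1 and NE2/3/4).  NEW file; nothing modified.  Net new unproved facts: 0.
-/

noncomputable section

set_option autoImplicit false

open scoped BigOperators InnerProductSpace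

namespace Literature.MathematicalPhysics.QuantumFieldTheory.Balaban1983to89.B9Eq326LocalInvTowerSliceGradientRow

open B4Sect5Torus (TSite tdist)
open B4TorusKernel.MultiPeriod (circAbs)
open B9SectCLatticeCarrier (Bond DirPair bpos btgt shift unshift)
open B9Eq311L2Pairing (WL2)
open B9Eq33CovDerivVector (covGrad)
open B11Eq103H1Complex (SiteL2K BondL2K covDivL2K covDerivL2K greenK apply_greenK)
open B9Eq310HessianOperator (adTransportW curvOp hessOp)
open B9Eq310DeltaPrime (reHol imHol)
open B7Prop1Explicit (U1 Wcx boxVec)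
open B9Eq319QprimeTorus (fineP blockCoord)
open B9Eq315QTorus (perCfg cornerSite)
open B9Eq315QTower (towerP UlevOf)
open B9Eq316TowerFlatIsOneStep (towerP_eq_fineP_pow siteCast)
open B9Eq326OperatorTower (QkW)
open B9Eq326LocalPartKatoForm (bondLapK weitzOpK localPart_eq_kato_add)
open B9Eq326LocalPartTowerSliceGradientRow (norm_covDerivL2K_slice_le_bigBlockLetter_smallGauge norm_covGrad_apply_le_of_slice)
open B9Eq326LocalPartTowerZerothOrderCoshRow (norm_zerothOrder_apply_le_weighted_cosh_tower)

/-! ## §1 The slice-gradient row of the tower local part `A₀,k⁻¹`, the value row displayed -/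

section Instance

variable {d : ℕ} (L : ℕ) [NeZero L] (m : Fin d → ℕ) [∀ i, NeZero (m i)] (n : ℕ)
  {𝔸 : Type*} [NormedRing 𝔸] [StarRing 𝔸] [NormedAlgebra ℂ 𝔸] [StarModule ℂ 𝔸] [CompleteSpace 𝔸] [NormOneClass 𝔸]
  {W : Type*} [NormedAddCommGroup W] [InnerProductSpace ℂ W] [FiniteDimensional ℂ W] (φ : W ≃ₗ[ℂ] 𝔸) {c₀ c₁ : ℝ} [Fact (0 < c₀)] [Fact (0 < c₁)]
  (U : Bond d (towerP L m (n + 1)) → 𝔸ˣ) (hL : 1 ≤ L) (α : ℕ → ℝ) (hα0 : ∀ j, 0 ≤ α j) (hα1 : ∀ j, α j ≤ 1 / 64)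
  (hU1 : ∀ (j : ℕ) (x : B7Prop1Explicit.Site d) (k : Fin d), perCfg (towerP L m (j + 1)) (UlevOf L m (n + 1) U j) x k ∈ U1 𝔸)
  (hreg : ∀ (j : ℕ) (y : TSite d (towerP L m j)) (k : Fin d) (ρ : Fin d → Fin L),
    ‖((Wcx L (perCfg (towerP L m (j + 1)) (UlevOf L m (n + 1) U j)) (cornerSite L y) k (boxVec L ρ) : 𝔸ˣ) : 𝔸) - 1‖ ≤ α j)
  {Mφ Mφ' : ℝ} (hMφ : 0 ≤ Mφ) (hφ : ∀ w, ‖φ w‖ ≤ Mφ * ‖w‖) (hMφ' : 0 ≤ Mφ') (hφ' : ∀ X, ‖φ.symm X‖ ≤ Mφ' * ‖X‖) (hstar : ∀ X : 𝔸, ‖star X‖ ≤ ‖X‖)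
  (εU : ℕ → ℝ) (hεU : ∀ j, 0 ≤ εU j)
  (hUε : ∀ (j : ℕ) (b : Bond d (towerP L m (j + 1))), ‖(UlevOf L m (n + 1) U j b : 𝔸) - 1‖ ≤ εU j)
  {r εs : ℝ} (hr0 : 0 ≤ r) (hr1 : r < 1) (hεs : 0 ≤ εs) (hεg : ∀ j < n + 1, εU j ≤ εs * r ^ j)
  (τ : 𝔸 →ₗ[ℂ] ℂ) {Mτ : ℝ} (hτ : ∀ X Y : 𝔸, ‖τ (X * Y)‖ ≤ Mτ * ‖X‖ * ‖Y‖) (hMτ : 0 ≤ Mτ)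
  {η : ℝ} (hη : 0 < η) (hUb : ∀ b, U b ∈ U1 𝔸) {δ : ℝ} (hδ : 0 ≤ δ)
  (hRe : ∀ p : B9SectCLatticeCarrier.Plaq d (towerP L m (n + 1)), ‖reHol U p - 1‖ ≤ δ)
  (hIm : ∀ p : B9SectCLatticeCarrier.Plaq d (towerP L m (n + 1)), ‖imHol U p‖ ≤ δ)
  {εt aU : ℝ} (hεt : 0 ≤ εt) (haU : 0 ≤ aU) (hUεt : ∀ b, ‖(U b : 𝔸) - 1‖ ≤ εt)
  (hUa : ∀ (x : TSite d (towerP L m (n + 1))) (μ : Fin d), ‖(U (x, μ) : 𝔸) - (U (unshift μ x, μ) : 𝔸)‖ ≤ aU)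
  {PB : TSite d m → BondL2K ℂ d (towerP L m (n + 1)) c₀ W →L[ℂ] BondL2K ℂ d (towerP L m (n + 1)) c₀ W}
  (hPB : ∀ (y : TSite d m) (f : BondL2K ℂ d (towerP L m (n + 1)) c₀ W) (b : Bond d (towerP L m (n + 1))),
    WL2.equiv ℂ (fun _ : Bond d (towerP L m (n + 1)) => c₀) W (PB y f) b =
      if blockCoord (L ^ (n + 1)) m (siteCast (towerP_eq_fineP_pow L m (n + 1)) b.1) = y then
        WL2.equiv ℂ (fun _ : Bond d (towerP L m (n + 1)) => c₀) W f b else 0)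
  (mm θ : ℝ) (hmm : 0 < mm)


include hα0 hMφ hφ hMφ' hφ' hstar hεU hUε hr0 hr1 hεs hεg hτ hMτ hη hUb hδ hRe hIm hεt haU hUεt hUa hPB hmm in
/-- **THE SLICE-GRADIENT ROW OF THE TOWER LOCAL PART `∇_U A₀,k⁻¹`, THE VALUE ROW DISPLAYED** (slice twin of ne9-leaf-03's (DVT) §2
`B9Eq326LocalPartTowerDivergenceRow.norm_covDivL2K_localInvK_le_bigBlockLetter` — THE SAME BINDER LIST; bond-operator twin of this lineage's (GT)
`B9Eq342GreenPrimeTowerGradientRow.norm_covDeriv_GpOfUk_le_blockLetter`).  On the bonds of `T_{(L^{n+1}m)}` (`1 ≤ m_i`, `1 ≤ d`, `N_ν ≥ 2`): the tower local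
part `A₀ = Δ(U) + D_UD*_U + Q_k(U)†(a•Q_k(U))` (`Q_k := QkW`, `hA₀` as in (EA0S)∕(WST)) positive (`hpos₀`); the MODEL letters (`U(b) ∈ U1`, `‖U(b) − 1‖ ≤ ε_t`,
the bond-gradient datum `a_U`, the plaquette letters `δ`, the `Q_k` regularity letters with the loop window `Σ_{j<n+1}α_j ≤ A_Q` and the geometric bond window,
the diagonal `c₀(L^{n+1})^d = c₁`); (T) contractive transporters; the big-block family `P_y` (`hPB`); a source `f` supported over the bonds of ONE big block `v`
with `‖f(b)‖ ≤ F`; THE DECAYED VALUE ROW `‖(A₀⁻¹f)(b)‖ ≤ C_u·F·e^{−κ·d_m(Πb₋, v)}`, `0 ≤ κ ≤ θL^{n+1}` (DISPLAYED — supplier (EA0S)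
`B9Eq326LocalPartTowerSupDecay.norm_localInvK_apply_le_decay` ∕ (ECL)); storey J's `cosh` currency (rate `θ ≥ 0`, comparison mass `m_c > 2dη⁻²(cosh θ − 1)`,
windows `0 < β ≤ B_ν`, `θ ≤ κ′`, `‖η⁻¹‖B_ν ≤ C ≤ K∕√m_c`, `2(|η⁻¹|·2M_φM_φ′ε_t)(e^{κ′}+1)dK ≤ √m_c`).  THEN for every component `μ` and every fine bond `b`:
`‖(D_U(A₀⁻¹f)_μ)(b)‖ ≤ 2e^{θ(L^{n+1}−1)}·((2‖η⁻¹‖) + (2(‖η⁻¹‖((c_P + m_c) + dη⁻²(b′ + b²)) + |η⁻¹|b∕β)·C_u)·B_{b.2}·F·e^{−κ·d_m(Πb₊, v)}`, `b = 2M_φM_φ′ε_t`,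
`b′ = 2M_φM_φ′a_U`, `c_P` the constant of `B9Eq326LocalPartTowerZerothOrderCoshRow.norm_zerothOrder_apply_le_weighted_cosh_tower` at `κ := η⁻²` — §1 at
`t := η⁻¹`, `P := Δ′ + Q_k†(a•Q_k) − η⁻²𝒦` (`B9Eq326LocalPartKatoForm.localPart_eq_kato_add` at `u := A₀⁻¹f`, `apply_greenK`), `hPuv` := that row.
[cite: Balaban1985BackgroundPropagators, Thm 3.1 (3.42) p.397, (3.3) p.391, (3.26) p.395, (3.23) p.394, (3.49) p.399, (3.69)–(3.73) pp.404–405, Thm 3.11 p.416,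
Thm 3.13 p.426; Balaban1985Variational, (115) p.294, (117) p.295, (134)–(136) p.298; Balaban1984PropagatorsI, p.36] -/
theorem norm_covDerivL2K_slice_localInvK_le_bigBlockLetter [DecidableEq (Bond d (towerP L m (n + 1)))] (hm : ∀ i, 1 ≤ m i) (hd : 1 ≤ d)
    (hn : ∀ ν, 2 ≤ towerP L m (n + 1) ν)
    (hR : ∀ (b : Bond d (towerP L m (n + 1))) (w : W), ‖adTransportW φ U b w‖ ≤ ‖w‖)
    (hS : ∀ (b : Bond d (towerP L m (n + 1))) (w : W), ‖adTransportW φ (fun bb => (U bb)⁻¹) b w‖ ≤ ‖w‖)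
    (a : ℝ) (A₀ : BondL2K ℂ d (towerP L m (n + 1)) c₀ W →ₗ[ℂ] BondL2K ℂ d (towerP L m (n + 1)) c₀ W)
    (hA₀ : A₀ = hessOp φ η U τ + covDerivL2K ℂ c₀ ((η : ℂ))⁻¹ (adTransportW φ U) ∘ₗ covDivL2K ℂ c₀ ((η : ℂ))⁻¹ (adTransportW φ fun b => (U b)⁻¹) +
      LinearMap.adjoint (QkW L m n φ U hL α hα1 hU1 hreg (c₀ := c₀) (c₁ := c₁)) ∘ₗ ((a : ℂ) • QkW L m n φ U hL α hα1 hU1 hreg (c₀ := c₀) (c₁ := c₁)))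
    (hpos₀ : ∀ x : BondL2K ℂ d (towerP L m (n + 1)) c₀ W, x ≠ 0 → 0 < RCLike.re ⟪x, A₀ x⟫_ℂ)
    (hw : c₀ * ((L : ℝ) ^ (n + 1)) ^ d = c₁) {AQ : ℝ} (hAQ : ∑ j ∈ Finset.range (n + 1), α j ≤ AQ)
    (hθ : 0 ≤ θ) (hlam : 2 * (d : ℝ) * η⁻¹ ^ 2 * (Real.cosh θ - 1) < mm)
    (v : TSite d m) (f : BondL2K ℂ d (towerP L m (n + 1)) c₀ W) {F Cu κ : ℝ} (hF : 0 ≤ F) (hCu : 0 ≤ Cu) (hκ : 0 ≤ κ)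
    (hκθ : κ ≤ θ * (L : ℝ) ^ (n + 1))
    (hfv : ∀ b : Bond d (towerP L m (n + 1)), blockCoord (L ^ (n + 1)) m (siteCast (towerP_eq_fineP_pow L m (n + 1)) b.1) ≠ v → WL2.equiv ℂ (fun _ : Bond d (towerP L m (n + 1)) => c₀) W f b = 0)
    (hfF : ∀ b : Bond d (towerP L m (n + 1)), ‖WL2.equiv ℂ (fun _ : Bond d (towerP L m (n + 1)) => c₀) W f b‖ ≤ F)
    (hudec : ∀ b : Bond d (towerP L m (n + 1)), ‖WL2.equiv ℂ (fun _ : Bond d (towerP L m (n + 1)) => c₀) W (greenK A₀ hpos₀ f) b‖ ≤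
      Cu * F * Real.exp (-(κ * tdist m (blockCoord (L ^ (n + 1)) m (siteCast (towerP_eq_fineP_pow L m (n + 1)) b.1)) v)))
    {β : ℝ} (hβ : 0 < β) (hβB : ∀ ν, β ≤ (fun ν : Fin d => (1 + Real.exp (-θ)) *
    ((1 + 2 * η⁻¹ / (towerP L m (n + 1) ν * Real.sqrt (mm - 2 * ((d : ℝ) - 1) * η⁻¹ ^ 2 * (Real.cosh θ - 1)))) /
      Real.sqrt ((mm - 2 * ((d : ℝ) - 1) * η⁻¹ ^ 2 * (Real.cosh θ - 1)) ^ 2 + 4 * (mm - 2 * ((d : ℝ) - 1) * η⁻¹ ^ 2 * (Real.cosh θ - 1)) * η⁻¹ ^ 2)) +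
    2 * Real.sinh θ / (mm - 2 * (d : ℝ) * η⁻¹ ^ 2 * (Real.cosh θ - 1))) ν) {κ' C K : ℝ} (hθκ : θ ≤ κ') (hC : 0 ≤ C) (htB : ∀ ν, ‖((η⁻¹ : ℝ) : ℂ)‖ * (fun ν : Fin d => (1 + Real.exp (-θ)) *
    ((1 + 2 * η⁻¹ / (towerP L m (n + 1) ν * Real.sqrt (mm - 2 * ((d : ℝ) - 1) * η⁻¹ ^ 2 * (Real.cosh θ - 1)))) /
      Real.sqrt ((mm - 2 * ((d : ℝ) - 1) * η⁻¹ ^ 2 * (Real.cosh θ - 1)) ^ 2 + 4 * (mm - 2 * ((d : ℝ) - 1) * η⁻¹ ^ 2 * (Real.cosh θ - 1)) * η⁻¹ ^ 2)) +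
    2 * Real.sinh θ / (mm - 2 * (d : ℝ) * η⁻¹ ^ 2 * (Real.cosh θ - 1))) ν ≤ C)
    (hCK : C ≤ K / Real.sqrt mm) (hmK : 2 * ((|η⁻¹| * (2 * Mφ * Mφ' * εt)) * (Real.exp κ' + 1) * (d : ℝ) * K) ≤ Real.sqrt mm)
    (μ : Fin d) (bnd : Bond d (towerP L m (n + 1))) :
    ‖WL2.equiv ℂ (fun _ : Bond d (towerP L m (n + 1)) => c₀) W
        (covDerivL2K ℂ c₀ ((η : ℂ))⁻¹ (adTransportW φ U) ((WL2.equiv ℂ (fun _ : TSite d (towerP L m (n + 1)) => c₀) W).symm fun y => WL2.equiv ℂ (fun _ : Bond d (towerP L m (n + 1)) => c₀) W (greenK A₀ hpos₀ f) (y, μ))) bnd‖ ≤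
      2 * Real.exp (θ * ((L : ℝ) ^ (n + 1) - 1)) *
        ((2 * ‖((η⁻¹ : ℝ) : ℂ)‖) +
          (2 * (‖((η⁻¹ : ℝ) : ℂ)‖ * ((
              (768 * Fintype.card (DirPair d) * Mτ * Mφ ^ 2 * (‖((η : ℂ)) ^ d‖ / c₀) * ‖((η : ℂ))⁻¹‖ ^ 2 * δ * Real.exp θ ^ 2 +
                |a| * (Mφ' * Mφ * Real.exp (100 * d * (d + 1) * (L : ℝ) ^ d * AQ) * ((2 * d : ℕ) : ℝ) *
                  ((Mφ' * Mφ * Real.exp (Real.sqrt ((L : ℝ) ^ d) * (Real.sqrt (2 * d) * (102 * (d + 1) ^ 2 * L)) * (εs / (1 - r)))) / Real.sqrt c₁ *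
                    (2 * ((Fintype.card (Option (Fin d × Bool)) : ℝ) * (Real.sqrt (c₀ * (d * ((L : ℝ) ^ (n + 1)) ^ d))))))) *
                  Real.exp (θ * (d : ℝ) * ((L : ℝ) ^ (n + 1) * 1 + ((L : ℝ) ^ (n + 1) - 1))) +
                ‖((η : ℂ))⁻¹ * ((η : ℂ))⁻¹‖ * ((d - 1 : ℝ) * (2 * Mφ * Mφ' * (2 * δ)) * Real.exp θ ^ 2)) + ‖((mm : ℝ) : ℂ)‖) +
              (d : ℝ) * (η⁻¹ ^ 2 * (2 * Mφ * Mφ' * aU + (2 * Mφ * Mφ' * εt) * (2 * Mφ * Mφ' * εt)))) + |η⁻¹| * (2 * Mφ * Mφ' * εt) / β) * Cu)) *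
        (fun ν : Fin d => (1 + Real.exp (-θ)) *
    ((1 + 2 * η⁻¹ / (towerP L m (n + 1) ν * Real.sqrt (mm - 2 * ((d : ℝ) - 1) * η⁻¹ ^ 2 * (Real.cosh θ - 1)))) /
      Real.sqrt ((mm - 2 * ((d : ℝ) - 1) * η⁻¹ ^ 2 * (Real.cosh θ - 1)) ^ 2 + 4 * (mm - 2 * ((d : ℝ) - 1) * η⁻¹ ^ 2 * (Real.cosh θ - 1)) * η⁻¹ ^ 2)) +
    2 * Real.sinh θ / (mm - 2 * (d : ℝ) * η⁻¹ ^ 2 * (Real.cosh θ - 1))) bnd.2 * F * Real.exp (-(κ * tdist m (blockCoord (L ^ (n + 1)) m (siteCast (towerP_eq_fineP_pow L m (n + 1)) (btgt bnd))) v)) := by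
  have ht : (0 : ℝ) < η⁻¹ := inv_pos.2 hη
  have hinv : ((η : ℂ))⁻¹ = ((η⁻¹ : ℝ) : ℂ) := (Complex.ofReal_inv η).symm
  have hd1 : (0 : ℝ) ≤ (d : ℝ) - 1 := sub_nonneg.mpr (by exact_mod_cast hd)
  have hc₀ : 0 < c₀ := Fact.out
  have hc₁ : 0 < c₁ := Fact.out
  -- the Kato form of `A₀` at `u := A₀⁻¹f`: `L_K u + P u = f`, `P = Δ′ + Q_k†(a•Q_k) − η⁻²𝒦`
  have hkato := localPart_eq_kato_add (hA₀ := hA₀)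
  have hu : bondLapK ℂ c₀ ((η⁻¹ : ℝ) : ℂ) (adTransportW φ U) (adTransportW φ fun b => (U b)⁻¹) (greenK A₀ hpos₀ f) +
      (curvOp φ τ η U + LinearMap.adjoint (QkW L m n φ U hL α hα1 hU1 hreg (c₀ := c₀) (c₁ := c₁)) ∘ₗ
            ((a : ℂ) • QkW L m n φ U hL α hα1 hU1 hreg (c₀ := c₀) (c₁ := c₁)) -
          (((η : ℂ))⁻¹ * ((η : ℂ))⁻¹) • weitzOpK ℂ c₀ (adTransportW φ U) (adTransportW φ fun b => (U b)⁻¹) :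
          BondL2K ℂ d (towerP L m (n + 1)) c₀ W →ₗ[ℂ] BondL2K ℂ d (towerP L m (n + 1)) c₀ W) (greenK A₀ hpos₀ f) = f := by
    rw [← hinv]
    have e : bondLapK ℂ c₀ ((η : ℂ))⁻¹ (adTransportW φ U) (adTransportW φ fun b => (U b)⁻¹) (greenK A₀ hpos₀ f) +
        (curvOp φ τ η U + LinearMap.adjoint (QkW L m n φ U hL α hα1 hU1 hreg (c₀ := c₀) (c₁ := c₁)) ∘ₗ
            ((a : ℂ) • QkW L m n φ U hL α hα1 hU1 hreg (c₀ := c₀) (c₁ := c₁)) -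
          (((η : ℂ))⁻¹ * ((η : ℂ))⁻¹) • weitzOpK ℂ c₀ (adTransportW φ U) (adTransportW φ fun b => (U b)⁻¹) :
          BondL2K ℂ d (towerP L m (n + 1)) c₀ W →ₗ[ℂ] BondL2K ℂ d (towerP L m (n + 1)) c₀ W) (greenK A₀ hpos₀ f) =
        ((bondLapK ℂ c₀ ((η : ℂ))⁻¹ (adTransportW φ U) (adTransportW φ fun b => (U b)⁻¹) +
            LinearMap.adjoint (QkW L m n φ U hL α hα1 hU1 hreg (c₀ := c₀) (c₁ := c₁)) ∘ₗ
              ((a : ℂ) • QkW L m n φ U hL α hα1 hU1 hreg (c₀ := c₀) (c₁ := c₁))) +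
          (curvOp φ τ η U - (((η : ℂ))⁻¹ * ((η : ℂ))⁻¹) • weitzOpK ℂ c₀ (adTransportW φ U) (adTransportW φ fun b => (U b)⁻¹)) :
            BondL2K ℂ d (towerP L m (n + 1)) c₀ W →ₗ[ℂ] BondL2K ℂ d (towerP L m (n + 1)) c₀ W) (greenK A₀ hpos₀ f) := by
      simp only [LinearMap.add_apply, LinearMap.sub_apply]
      abel
    rw [e, ← hkato]
    exact apply_greenK hpos₀ f
  -- the zeroth-order row of `B9Eq326LocalPartTowerZerothOrderCoshRow` as the `hPuv` slot, at `κ := η⁻²`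
  have hcP : 0 ≤ (768 * Fintype.card (DirPair d) * Mτ * Mφ ^ 2 * (‖((η : ℂ)) ^ d‖ / c₀) * ‖((η : ℂ))⁻¹‖ ^ 2 * δ * Real.exp θ ^ 2 +
                |a| * (Mφ' * Mφ * Real.exp (100 * d * (d + 1) * (L : ℝ) ^ d * AQ) * ((2 * d : ℕ) : ℝ) *
                  ((Mφ' * Mφ * Real.exp (Real.sqrt ((L : ℝ) ^ d) * (Real.sqrt (2 * d) * (102 * (d + 1) ^ 2 * L)) * (εs / (1 - r)))) / Real.sqrt c₁ *
                    (2 * ((Fintype.card (Option (Fin d × Bool)) : ℝ) * (Real.sqrt (c₀ * (d * ((L : ℝ) ^ (n + 1)) ^ d))))))) *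
                  Real.exp (θ * (d : ℝ) * ((L : ℝ) ^ (n + 1) * 1 + ((L : ℝ) ^ (n + 1) - 1))) +
                ‖((η : ℂ))⁻¹ * ((η : ℂ))⁻¹‖ * ((d - 1 : ℝ) * (2 * Mφ * Mφ' * (2 * δ)) * Real.exp θ ^ 2)) := by
    have h3 : 0 ≤ ‖((η : ℂ))⁻¹ * ((η : ℂ))⁻¹‖ * ((d - 1 : ℝ) * (2 * Mφ * Mφ' * (2 * δ)) * Real.exp θ ^ 2) :=
      mul_nonneg (norm_nonneg _) (mul_nonneg (mul_nonneg hd1 (by positivity)) (by positivity))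
    exact add_nonneg (add_nonneg (by positivity) (by positivity)) h3
  have h := norm_covDerivL2K_slice_le_bigBlockLetter_smallGauge L m n φ hφ hφ' hMφ hMφ' η⁻¹ mm θ hmm U hUb hεt haU hUεt hUa ht hθ hlam hn hR hS
    (curvOp φ τ η U + LinearMap.adjoint (QkW L m n φ U hL α hα1 hU1 hreg (c₀ := c₀) (c₁ := c₁)) ∘ₗ
            ((a : ℂ) • QkW L m n φ U hL α hα1 hU1 hreg (c₀ := c₀) (c₁ := c₁)) -
          (((η : ℂ))⁻¹ * ((η : ℂ))⁻¹) • weitzOpK ℂ c₀ (adTransportW φ U) (adTransportW φ fun b => (U b)⁻¹) :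
          BondL2K ℂ d (towerP L m (n + 1)) c₀ W →ₗ[ℂ] BondL2K ℂ d (towerP L m (n + 1)) c₀ W)
    (greenK A₀ hpos₀ f) f hu v hF hCu hκ hκθ hcP hfv hfF hudec
    (fun y' Nu hNu hv => norm_zerothOrder_apply_le_weighted_cosh_tower L m n φ U hL α hα0 hα1 hU1 hreg hMφ hφ hMφ' hφ' hstar εU hεU hUε hr0 hr1
      hεs hεg τ hτ hMτ η hUb hδ hRe hIm hPB θ hm hAQ hw hθ hR hS a (((η : ℂ))⁻¹ * ((η : ℂ))⁻¹) (greenK A₀ hpos₀ f) y' Nu hNu hv)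
    hβ hβB hθκ hC htB hCK hmK μ bnd
  have e2 : covDerivL2K ℂ c₀ ((η : ℂ))⁻¹ (adTransportW φ U) =
      covDerivL2K ℂ c₀ ((η⁻¹ : ℝ) : ℂ) (adTransportW φ U) := by rw [hinv]
  rw [e2]
  exact h


include hα0 hMφ hφ hMφ' hφ' hstar hεU hUε hr0 hr1 hεs hεg hτ hMτ hη hUb hδ hRe hIm hεt haU hUεt hUa hPB hmm in
/-- **THE SAME ROW READ AS `‖(∇_U A₀,k⁻¹f)(b, μ)‖`** — `B9Eq33CovDerivVector.covGrad η⁻¹ (Ad U)` of the bond field `A₀,k⁻¹f` at `(b, μ)` (the letter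
`B11Eq111FrakG.nabla115 η U` of the space (115), pointwise): §1 through (VGT-a) `norm_covGrad_apply_le_of_slice`. [folklore]
[cite: Balaban1985BackgroundPropagators, (3.3) p.391, Thm 3.1 (3.42) p.397, Thm 3.13 p.426; Balaban1985Variational, (115) p.294, (117) p.295] -/
theorem norm_covGrad_localInvK_le_bigBlockLetter [DecidableEq (Bond d (towerP L m (n + 1)))] (hm : ∀ i, 1 ≤ m i) (hd : 1 ≤ d)
    (hn : ∀ ν, 2 ≤ towerP L m (n + 1) ν)
    (hR : ∀ (b : Bond d (towerP L m (n + 1))) (w : W), ‖adTransportW φ U b w‖ ≤ ‖w‖)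
    (hS : ∀ (b : Bond d (towerP L m (n + 1))) (w : W), ‖adTransportW φ (fun bb => (U bb)⁻¹) b w‖ ≤ ‖w‖)
    (a : ℝ) (A₀ : BondL2K ℂ d (towerP L m (n + 1)) c₀ W →ₗ[ℂ] BondL2K ℂ d (towerP L m (n + 1)) c₀ W)
    (hA₀ : A₀ = hessOp φ η U τ + covDerivL2K ℂ c₀ ((η : ℂ))⁻¹ (adTransportW φ U) ∘ₗ covDivL2K ℂ c₀ ((η : ℂ))⁻¹ (adTransportW φ fun b => (U b)⁻¹) +
      LinearMap.adjoint (QkW L m n φ U hL α hα1 hU1 hreg (c₀ := c₀) (c₁ := c₁)) ∘ₗ ((a : ℂ) • QkW L m n φ U hL α hα1 hU1 hreg (c₀ := c₀) (c₁ := c₁)))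
    (hpos₀ : ∀ x : BondL2K ℂ d (towerP L m (n + 1)) c₀ W, x ≠ 0 → 0 < RCLike.re ⟪x, A₀ x⟫_ℂ)
    (hw : c₀ * ((L : ℝ) ^ (n + 1)) ^ d = c₁) {AQ : ℝ} (hAQ : ∑ j ∈ Finset.range (n + 1), α j ≤ AQ)
    (hθ : 0 ≤ θ) (hlam : 2 * (d : ℝ) * η⁻¹ ^ 2 * (Real.cosh θ - 1) < mm)
    (v : TSite d m) (f : BondL2K ℂ d (towerP L m (n + 1)) c₀ W) {F Cu κ : ℝ} (hF : 0 ≤ F) (hCu : 0 ≤ Cu) (hκ : 0 ≤ κ)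
    (hκθ : κ ≤ θ * (L : ℝ) ^ (n + 1))
    (hfv : ∀ b : Bond d (towerP L m (n + 1)), blockCoord (L ^ (n + 1)) m (siteCast (towerP_eq_fineP_pow L m (n + 1)) b.1) ≠ v → WL2.equiv ℂ (fun _ : Bond d (towerP L m (n + 1)) => c₀) W f b = 0)
    (hfF : ∀ b : Bond d (towerP L m (n + 1)), ‖WL2.equiv ℂ (fun _ : Bond d (towerP L m (n + 1)) => c₀) W f b‖ ≤ F)
    (hudec : ∀ b : Bond d (towerP L m (n + 1)), ‖WL2.equiv ℂ (fun _ : Bond d (towerP L m (n + 1)) => c₀) W (greenK A₀ hpos₀ f) b‖ ≤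
      Cu * F * Real.exp (-(κ * tdist m (blockCoord (L ^ (n + 1)) m (siteCast (towerP_eq_fineP_pow L m (n + 1)) b.1)) v)))
    {β : ℝ} (hβ : 0 < β) (hβB : ∀ ν, β ≤ (fun ν : Fin d => (1 + Real.exp (-θ)) *
    ((1 + 2 * η⁻¹ / (towerP L m (n + 1) ν * Real.sqrt (mm - 2 * ((d : ℝ) - 1) * η⁻¹ ^ 2 * (Real.cosh θ - 1)))) /
      Real.sqrt ((mm - 2 * ((d : ℝ) - 1) * η⁻¹ ^ 2 * (Real.cosh θ - 1)) ^ 2 + 4 * (mm - 2 * ((d : ℝ) - 1) * η⁻¹ ^ 2 * (Real.cosh θ - 1)) * η⁻¹ ^ 2)) +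
    2 * Real.sinh θ / (mm - 2 * (d : ℝ) * η⁻¹ ^ 2 * (Real.cosh θ - 1))) ν) {κ' C K : ℝ} (hθκ : θ ≤ κ') (hC : 0 ≤ C) (htB : ∀ ν, ‖((η⁻¹ : ℝ) : ℂ)‖ * (fun ν : Fin d => (1 + Real.exp (-θ)) *
    ((1 + 2 * η⁻¹ / (towerP L m (n + 1) ν * Real.sqrt (mm - 2 * ((d : ℝ) - 1) * η⁻¹ ^ 2 * (Real.cosh θ - 1)))) /
      Real.sqrt ((mm - 2 * ((d : ℝ) - 1) * η⁻¹ ^ 2 * (Real.cosh θ - 1)) ^ 2 + 4 * (mm - 2 * ((d : ℝ) - 1) * η⁻¹ ^ 2 * (Real.cosh θ - 1)) * η⁻¹ ^ 2)) +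
    2 * Real.sinh θ / (mm - 2 * (d : ℝ) * η⁻¹ ^ 2 * (Real.cosh θ - 1))) ν ≤ C)
    (hCK : C ≤ K / Real.sqrt mm) (hmK : 2 * ((|η⁻¹| * (2 * Mφ * Mφ' * εt)) * (Real.exp κ' + 1) * (d : ℝ) * K) ≤ Real.sqrt mm)
    (μ : Fin d) (bnd : Bond d (towerP L m (n + 1))) :
    ‖covGrad ((η : ℂ))⁻¹ (adTransportW φ U) (WL2.equiv ℂ (fun _ : Bond d (towerP L m (n + 1)) => c₀) W (greenK A₀ hpos₀ f)) (bnd, μ)‖ ≤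
      2 * Real.exp (θ * ((L : ℝ) ^ (n + 1) - 1)) *
        ((2 * ‖((η⁻¹ : ℝ) : ℂ)‖) +
          (2 * (‖((η⁻¹ : ℝ) : ℂ)‖ * ((
              (768 * Fintype.card (DirPair d) * Mτ * Mφ ^ 2 * (‖((η : ℂ)) ^ d‖ / c₀) * ‖((η : ℂ))⁻¹‖ ^ 2 * δ * Real.exp θ ^ 2 +
                |a| * (Mφ' * Mφ * Real.exp (100 * d * (d + 1) * (L : ℝ) ^ d * AQ) * ((2 * d : ℕ) : ℝ) *
                  ((Mφ' * Mφ * Real.exp (Real.sqrt ((L : ℝ) ^ d) * (Real.sqrt (2 * d) * (102 * (d + 1) ^ 2 * L)) * (εs / (1 - r)))) / Real.sqrt c₁ *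
                    (2 * ((Fintype.card (Option (Fin d × Bool)) : ℝ) * (Real.sqrt (c₀ * (d * ((L : ℝ) ^ (n + 1)) ^ d))))))) *
                  Real.exp (θ * (d : ℝ) * ((L : ℝ) ^ (n + 1) * 1 + ((L : ℝ) ^ (n + 1) - 1))) +
                ‖((η : ℂ))⁻¹ * ((η : ℂ))⁻¹‖ * ((d - 1 : ℝ) * (2 * Mφ * Mφ' * (2 * δ)) * Real.exp θ ^ 2)) + ‖((mm : ℝ) : ℂ)‖) +
              (d : ℝ) * (η⁻¹ ^ 2 * (2 * Mφ * Mφ' * aU + (2 * Mφ * Mφ' * εt) * (2 * Mφ * Mφ' * εt)))) + |η⁻¹| * (2 * Mφ * Mφ' * εt) / β) * Cu)) *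
        (fun ν : Fin d => (1 + Real.exp (-θ)) *
    ((1 + 2 * η⁻¹ / (towerP L m (n + 1) ν * Real.sqrt (mm - 2 * ((d : ℝ) - 1) * η⁻¹ ^ 2 * (Real.cosh θ - 1)))) /
      Real.sqrt ((mm - 2 * ((d : ℝ) - 1) * η⁻¹ ^ 2 * (Real.cosh θ - 1)) ^ 2 + 4 * (mm - 2 * ((d : ℝ) - 1) * η⁻¹ ^ 2 * (Real.cosh θ - 1)) * η⁻¹ ^ 2)) +
    2 * Real.sinh θ / (mm - 2 * (d : ℝ) * η⁻¹ ^ 2 * (Real.cosh θ - 1))) bnd.2 * F * Real.exp (-(κ * tdist m (blockCoord (L ^ (n + 1)) m (siteCast (towerP_eq_fineP_pow L m (n + 1)) (btgt bnd))) v)) :=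
  norm_covGrad_apply_le_of_slice _ _ _ bnd μ
    (norm_covDerivL2K_slice_localInvK_le_bigBlockLetter L m n φ U hL α hα0 hα1 hU1 hreg hMφ hφ hMφ' hφ' hstar εU hεU hUε hr0 hr1 hεs hεg τ hτ hMτ hη hUb
      hδ hRe hIm hεt haU hUεt hUa hPB mm θ hmm hm hd hn hR hS a A₀ hA₀ hpos₀ hw hAQ hθ hlam v f hF hCu hκ hκθ hfv hfF hudec hβ hβB hθκ hC htB hCK hmK μ bnd)

end Instance

end Literature.MathematicalPhysics.QuantumFieldTheory.Balaban1983to89.B9Eq326LocalInvTowerSliceGradientRow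

end
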